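import Literature.Analysis.FluidPDE.LocalTypeI
import Literature.Analysis.FluidPDE.PineauVicolCylinderRegularity
import Literature.Analysis.FluidPDE.PineauVicolLerayPressure
import Literature.Analysis.FluidPDE.ClassicalSuitable
import Literature.Analysis.FluidPDE.SuitableWeakPressure
import Literature.Analysis.FluidPDE.NSCriticalClosureBesovProofs
import HarnessLib

/-!
# Crux `FrequencyRigidity` (stmt-NavierStokesRegularity-2955), line `scaled-energy-split`:
# pressure-mass tools for decaying rotated self-similar flows

Helper file (`--supports stmt-NavierStokesRegularity-2955`; theorems only, sorry-free), ending
with the registered tools stub `stub_rssPressureMassTools`, consumed by the stub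
`stub_rssDecaySuitableInBall` of the line (decaying rotated self-similar flows
`u = pvAnsatz α U`, `‖U(y)‖ ≤ C₀/(1+‖y‖)`, are suitable weak solutions in the unit parabolic
ball in Albritton–Barker's class).  The pressure part of that class, `p − c(t) ∈ L^{3/2}(Q)`,
is the subject of this file.

* `rss_lintegral_enorm_sq_pressurePotential_le` — **the pressure potential of the decay class
  is globally square integrable**: `∫_{ℝ³} |Q[V]|² ≤ K C₀⁴` for every smooth `V` with
  `‖V(y)‖ ≤ C₀/(1+‖y‖)` (`Q[V] = pressurePotential V`, Tao's `−Δ⁻¹∂ᵢ∂ⱼ(VᵢVⱼ)` realised by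
  Newtonian potentials).  Proof: for the smooth cut-offs `wₙ = χₙ V` the tree's `L²`
  Calderón–Zygmund bound `‖p̃[w]‖₂ ≤ C_S ‖|w|²‖₂` (Stein 1970, proved in
  `NormalisedPressureL2Bound`) and `Q[w] = p̃[w]` (Tao 2011, (35)) give
  `∫ |Q[wₙ]|² ≤ C_S² C₀⁴ ∫ (1+|y|)⁻⁴`; `Q[wₙ] → Q[V]` pointwise, and Fatou.
* `rss_lintegral_ball_rpow_pressurePotential_le` — the slice bound
  `∫_{B₁} |Q[λV(λ·)]|^{3/2} ≤ (λ K C₀⁴)^{3/4} |B₁|^{1/4}` (Hölder on `B₁`, the dilation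
  covariance `Q[λV(λ·)](x) = λ²Q[V](λx)` of `PineauVicolLerayPressure`, the global bound).
* `rss_pressure_sub_gauge_eq` — for a classical Type I solution on `(−∞, 0)` the pressure is
  the potential up to the time gauge `c(t) = p(t,0) − Q[u(t)](0)` (Pineau–Vicol 2026, proof of
  Lemma 7.1, footnote 21); `rss_gauge_integrableOn_compact` — the gauge is integrable and
  `L^{3/2}` on compact subsets of the unit parabolic ball (input of `sub_pressure`).

## References

* B. Pineau, V. Vicol, *On rotated backwards self-similar solutions of the incompressible 3D
  Navier–Stokes equations*, arXiv:2607.09619 (2026), Lemma 7.1 and its proof, footnote 21,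
  Remark 1.2. [PineauVicol2026]
* D. Albritton, T. Barker, J. Math. Fluid Mech. 21 (2019) = arXiv:1811.00502, Def. 2.1.
  [AlbrittonBarker2019]
* E. M. Stein, *Singular integrals and differentiability properties of functions* (1970),
  Ch. II §4.2 Thm 3. [Stein1971]
* T. Tao, *Localisation and compactness properties of the Navier–Stokes global regularity
  problem*, Anal. PDE 6 (2013), (35). [Tao2011]
-/

noncomputable section

-- the registered stub namespace repeats the summit name `NavierStokesRegularity` (summit = problem)
set_option linter.dupNamespace false

namespace Summit.NavierStokesRegularity.NavierStokesRegularity.Theorems.FrequencyRigidity.ScaledEnergySplit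

open Literature.Analysis.FluidPDE Literature.Analysis.FluidPDE.PineauVicol2026 MeasureTheory Set
  Filter Topology Function Metric
open scoped ENNReal NNReal ContDiff

-- nested operator types `ℝ³ →L[ℝ] ℝ³ →L[ℝ] ℝ`
set_option maxSynthPendingDepth 3

/-- **Global `L²` bound for the pressure potential on the decay class.** There is an absolute
`K` such that for every smooth `V : ℝ³ → ℝ³` with `‖V(y)‖ ≤ C₀/(1+‖y‖)` the pressure potential
`Q[V]` (`pressurePotential`) satisfies `∫ |Q[V]|² ≤ K C₀⁴`: cut `V` off smoothly at radius `n`,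
use `Q[w] = p̃[w]` and the tree's Calderón–Zygmund bound `‖p̃[w]‖₂ ≤ C_S ‖|w|²‖₂`
(`stein1970_normalisedPressure_eLpNorm_le_holds`) with `∫ |w|⁴ ≤ C₀⁴ ∫ (1+|y|)⁻⁴`, and pass to
the limit pointwise (near part local, far part by dominated convergence) with Fatou. [folklore] -/
theorem rss_lintegral_enorm_sq_pressurePotential_le :
    ∃ K : ℝ, 0 ≤ K ∧ ∀ (V : EuclideanSpace ℝ (Fin 3) → EuclideanSpace ℝ (Fin 3)) (C₀ : ℝ),
      ContDiff ℝ ∞ V → (∀ y, ‖V y‖ ≤ C₀ / (1 + ‖y‖)) →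
      ∫⁻ x, ‖pressurePotential V x‖ₑ ^ 2 ≤ ENNReal.ofReal (K * C₀ ^ 4) := by
  obtain ⟨CS, hCS0, hCS⟩ := stein1970_normalisedPressure_eLpNorm_le_holds
  set K₄ : ℝ := ∫ y : EuclideanSpace ℝ (Fin 3), ((1 + ‖y‖) ^ 4)⁻¹ with hK₄
  have hK₄0 : 0 ≤ K₄ := integral_nonneg fun y => by positivity
  refine ⟨CS ^ 2 * K₄, by positivity, fun V C₀ hV hdec => ?_⟩
  set w : ℕ → EuclideanSpace ℝ (Fin 3) → EuclideanSpace ℝ (Fin 3) :=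
    fun n y => cutoff ((n : ℝ) + 1) y • V y with hw
  have hn0 : ∀ n : ℕ, (0 : ℝ) < n + 1 := fun n => by positivity
  have hws : ∀ n, ContDiff ℝ ∞ (w n) := fun n => (contDiff_cutoff _).smul hV
  have hwc : ∀ n, HasCompactSupport (w n) := fun n =>
    (hasCompactSupport_cutoff (hn0 n)).smul_right
  have hwdec : ∀ n y, ‖w n y‖ ≤ C₀ / (1 + ‖y‖) := fun n y => by
    refine le_trans ?_ (hdec y)
    rw [hw]; dsimp only; rw [norm_smul, Real.norm_eq_abs]
    exact mul_le_of_le_one_left (norm_nonneg _) (abs_cutoff_le_one _ _)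
  have hw_eq : ∀ (n : ℕ) y, ‖y‖ ≤ (n : ℝ) + 1 → w n y = V y := fun n y hy => by
    rw [hw]; dsimp only; rw [cutoff_eq_one (hn0 n) hy, one_smul]
  have hstep1 : ∀ n, ∫⁻ x, ‖pressurePotential (w n) x‖ₑ ^ 2 ≤
      ENNReal.ofReal (CS ^ 2 * K₄ * C₀ ^ 4) := by
    intro n
    have hw2c : HasCompactSupport fun y => ‖w n y‖ ^ 2 :=
      (hwc n).norm.comp_left (g := fun t : ℝ => t ^ 2) (by norm_num)
    have hL2w : Integrable fun y => ‖w n y‖ ^ 2 :=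
      ((hws n).continuous.norm.pow 2).integrable_of_hasCompactSupport hw2c
    have hQw : pressurePotential (w n) = normalisedPressure (w n) :=
      (normalisedPressure_eq_pressurePotential' ((hws n).of_le (by norm_cast)) hL2w).symm
    obtain ⟨-, hle⟩ := hCS (w n) (hws n) (hwc n)
    rw [hQw, ← eLpNorm_two_sq_eq_lintegral]
    calc eLpNorm (normalisedPressure (w n)) 2 volume ^ 2
        ≤ (ENNReal.ofReal CS * eLpNorm (fun x => ‖w n x‖ ^ 2) 2 volume) ^ 2 := by gcongr
      _ = ENNReal.ofReal (CS ^ 2) * ∫⁻ y, ‖‖w n y‖ ^ 2‖ₑ ^ 2 := by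
          rw [mul_pow, eLpNorm_two_sq_eq_lintegral, ENNReal.ofReal_pow hCS0]
      _ ≤ ENNReal.ofReal (CS ^ 2) * ∫⁻ y, ENNReal.ofReal (C₀ ^ 4 * ((1 + ‖y‖) ^ 4)⁻¹) := by
          gcongr with y
          rw [Real.enorm_eq_ofReal (sq_nonneg _), ← ENNReal.ofReal_pow (sq_nonneg _)]
          refine ENNReal.ofReal_le_ofReal ?_
          calc (‖w n y‖ ^ 2) ^ 2 = ‖w n y‖ ^ 4 := by ring
            _ ≤ (C₀ / (1 + ‖y‖)) ^ 4 := pow_le_pow_left₀ (norm_nonneg _) (hwdec n y) 4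
            _ = C₀ ^ 4 * ((1 + ‖y‖) ^ 4)⁻¹ := by rw [div_pow, div_eq_mul_inv]
      _ = ENNReal.ofReal (CS ^ 2 * K₄ * C₀ ^ 4) := by
          rw [← ofReal_integral_eq_lintegral_ofReal
            ((integrable_inv_one_add_norm_pow le_rfl).const_mul _)
            (Eventually.of_forall fun y => by positivity), integral_const_mul,
            ← ENNReal.ofReal_mul (sq_nonneg _), ← hK₄]
          congr 1; ring
  have hlim : ∀ x, Tendsto (fun n => pressurePotential (w n) x) atTop
      (𝓝 (pressurePotential V x)) := by
    intro x
    have hnear : ∀ᶠ n : ℕ in atTop, nearPotential 1 2 (w n) x = nearPotential 1 2 V x := by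
      obtain ⟨N, hN⟩ := exists_nat_ge (‖x‖ + 3)
      filter_upwards [eventually_ge_atTop N] with n hn
      refine nearPotential_congr (r := 3) (by norm_num) fun y hy => hw_eq n y ?_
      rw [mem_ball, dist_eq_norm] at hy
      have := norm_le_norm_add_norm_sub' y x
      have hn' : (N : ℝ) ≤ n := by exact_mod_cast hn
      linarith
    have hfar : Tendsto (fun n => farPotential 1 2 (w n) x) atTop
        (𝓝 (farPotential 1 2 V x)) := by
      obtain ⟨⟨M, hM⟩, -, -⟩ := exists_hasDecay_fderiv_newtonFar one_pos one_lt_two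
      have hΦc := (contDiff_fderiv2_newtonFar one_pos one_lt_two).continuous
      simp only [farPotential_eq]
      refine tendsto_integral_of_dominated_convergence
        (fun y => M * C₀ ^ 2 * (2 + ‖x‖) ^ 3 * ((1 + ‖y‖) ^ 5)⁻¹) ?_ ?_ ?_ ?_
      · intro n
        exact ((continuous_evalDiag.comp (hws n).continuous).clm_apply
          (hΦc.comp (continuous_const.sub continuous_id))).aestronglyMeasurable
      · exact integrable_inv_one_add_norm_pow_five.const_mul _
      · intro n
        refine Eventually.of_forall fun y => ?_
        exact (ContinuousLinearMap.le_opNorm _ _).trans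
          (norm_mul_norm_comp_sub_le hM (hasDecay_two_evalDiag (hwdec n)) (by simp) y)
      · refine Eventually.of_forall fun y => ?_
        refine tendsto_const_nhds.congr' ?_
        obtain ⟨N, hN⟩ := exists_nat_ge ‖y‖
        filter_upwards [eventually_ge_atTop N] with n hn
        have hn' : (N : ℝ) ≤ n := by exact_mod_cast hn
        rw [hw_eq n y (by linarith)]
    have hnear' : Tendsto (fun n => nearPotential 1 2 (w n) x) atTop
        (𝓝 (nearPotential 1 2 V x)) :=
      tendsto_const_nhds.congr' (by filter_upwards [hnear] with n hn; rw [hn])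
    exact hnear'.neg.sub hfar
  have hmeas : ∀ n, AEMeasurable (fun x => ‖pressurePotential (w n) x‖ₑ ^ 2) volume := fun n =>
    ((contDiff_pressurePotential_decay ((hws n).of_le (by norm_cast))
      (hwdec n)).continuous.measurable.enorm.pow_const _).aemeasurable
  calc ∫⁻ x, ‖pressurePotential V x‖ₑ ^ 2
      = ∫⁻ x, liminf (fun n => ‖pressurePotential (w n) x‖ₑ ^ 2) atTop := by
        refine lintegral_congr fun x => (Tendsto.liminf_eq ?_).symm
        exact ((ENNReal.continuous_pow 2).tendsto _).comp
          ((continuous_enorm.tendsto _).comp (hlim x))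
    _ ≤ liminf (fun n => ∫⁻ x, ‖pressurePotential (w n) x‖ₑ ^ 2) atTop := lintegral_liminf_le' hmeas
    _ ≤ ENNReal.ofReal (CS ^ 2 * K₄ * C₀ ^ 4) :=
        liminf_le_of_frequently_le' (Frequently.of_forall hstep1)

/-- **Slice bound for the pressure potential of a dilated profile.** Let `K` be a constant of
`rss_lintegral_enorm_sq_pressurePotential_le`. If `v = λ V(λ ·)` (`λ > 0`) with `V` smooth in
the decay class `‖V(y)‖ ≤ C₀/(1+‖y‖)` (and `v` itself in some decay class, so that `Q[v]` is
continuous), then `∫_{B₁} |Q[v]|^{3/2} ≤ (λ K C₀⁴)^{3/4} |B₁|^{1/4}`: Hölder on the unit ball,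
the dilation covariance `Q[λV(λ·)](x) = λ² Q[V](λx)` (`pressurePotential_smul_comp_smul`) and
the global `L²` bound (change of variables `lintegral_comp_smul_three`). [folklore] -/
theorem rss_lintegral_ball_rpow_pressurePotential_le {K : ℝ}
    (hK : ∀ (V : EuclideanSpace ℝ (Fin 3) → EuclideanSpace ℝ (Fin 3)) (C₀ : ℝ),
      ContDiff ℝ ∞ V → (∀ y, ‖V y‖ ≤ C₀ / (1 + ‖y‖)) →
      ∫⁻ x, ‖pressurePotential V x‖ₑ ^ 2 ≤ ENNReal.ofReal (K * C₀ ^ 4))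
    {v : EuclideanSpace ℝ (Fin 3) → EuclideanSpace ℝ (Fin 3)} (hv : ContDiff ℝ ∞ v)
    {C₀ C₁ lam : ℝ} (hlam : 0 < lam) (hv₁ : ∀ x, ‖v x‖ ≤ C₁ / (1 + ‖x‖))
    (hV : ∀ y, ‖lam⁻¹ • v (lam⁻¹ • y)‖ ≤ C₀ / (1 + ‖y‖)) :
    ∫⁻ x in ball (0 : EuclideanSpace ℝ (Fin 3)) 1, ‖pressurePotential v x‖ₑ ^ (3 / 2 : ℝ) ≤
      ENNReal.ofReal (lam * (K * C₀ ^ 4)) ^ (3 / 4 : ℝ) *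
        volume (ball (0 : EuclideanSpace ℝ (Fin 3)) 1) ^ (1 / 4 : ℝ) := by
  set V : EuclideanSpace ℝ (Fin 3) → EuclideanSpace ℝ (Fin 3) :=
    fun y => lam⁻¹ • v (lam⁻¹ • y) with hVdef
  have hVs : ContDiff ℝ ∞ V := (hv.comp (contDiff_const_smul _)).const_smul _
  have hv_eq : v = fun x => lam • V (lam • x) := by
    funext x
    simp only [hVdef, smul_smul, mul_inv_cancel₀ hlam.ne', inv_mul_cancel₀ hlam.ne', one_smul]
  have hQc : Continuous (pressurePotential v) :=
    (contDiff_pressurePotential_decay (hv.of_le (by norm_cast)) hv₁).continuous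
  have hlam0 : lam ≠ 0 := hlam.ne'
  refine (lintegral_ball_rpow_three_halves_le hQc).trans ?_
  gcongr
  calc ∫⁻ x in ball (0 : EuclideanSpace ℝ (Fin 3)) 1, ‖pressurePotential v x‖ₑ ^ (2 : ℝ)
      ≤ ∫⁻ x, ‖pressurePotential v x‖ₑ ^ (2 : ℝ) := setLIntegral_le_lintegral _ _
    _ = ∫⁻ x, ENNReal.ofReal (lam ^ 4) * ‖pressurePotential V (lam • x)‖ₑ ^ 2 := by
        refine lintegral_congr fun x => ?_
        rw [ENNReal.rpow_two, hv_eq, pressurePotential_smul_comp_smul (hVs.of_le (by norm_cast))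
          hV hlam, enorm_mul, mul_pow, Real.enorm_eq_ofReal (sq_nonneg _),
          ← ENNReal.ofReal_pow (sq_nonneg _)]
        ring_nf
    _ = ENNReal.ofReal (lam ^ 4) *
          (ENNReal.ofReal ((lam ^ 3)⁻¹) * ∫⁻ y, ‖pressurePotential V y‖ₑ ^ 2) := by
        rw [lintegral_const_mul' _ _ ENNReal.ofReal_ne_top,
          lintegral_comp_smul_three (fun y => ‖pressurePotential V y‖ₑ ^ 2) hlam]
    _ ≤ ENNReal.ofReal (lam ^ 4) * (ENNReal.ofReal ((lam ^ 3)⁻¹) * ENNReal.ofReal (K * C₀ ^ 4)) := by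
        gcongr
        exact hK V C₀ hVs hV
    _ = ENNReal.ofReal (lam * (K * C₀ ^ 4)) := by
        rw [← mul_assoc, ← ENNReal.ofReal_mul (by positivity), ← ENNReal.ofReal_mul (by positivity)]
        congr 1
        field_simp

/-- `∫_{-1}^{0} (−t)^r dt < ∞` for `r > −1`, in `ℝ≥0∞` form. [folklore] -/
theorem rss_lintegral_Ioo_neg_rpow_lt_top {r : ℝ} (hr : -1 < r) :
    ∫⁻ t in Ioo (-1 : ℝ) 0, ENNReal.ofReal ((-t) ^ r) < ⊤ := by
  have hi : IntervalIntegrable (fun x : ℝ => x ^ r) volume 0 1 :=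
    intervalIntegral.intervalIntegrable_rpow' hr
  have h1 := hi.comp_sub_left 0
  rw [sub_zero, zero_sub] at h1
  have h2 : IntegrableOn (fun t : ℝ => (0 - t) ^ r) (Ioo (-1 : ℝ) 0) :=
    h1.symm.1.mono_set Ioo_subset_Ioc_self
  refine lt_of_le_of_lt (lintegral_mono fun t => ?_) h2.2
  have e : (fun t : ℝ => (0 - t) ^ r) t = (-t) ^ r := by simp only [zero_sub]
  rw [e]
  exact Real.ofReal_le_enorm _

/-! ## The pressure gauge of a Type I classical solution on `(−∞, 0)` -/

variable {u : ℝ → EuclideanSpace ℝ (Fin 3) → EuclideanSpace ℝ (Fin 3)}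
  {p : ℝ → EuclideanSpace ℝ (Fin 3) → ℝ} {C₀ : ℝ}

/-- A Type I profile `‖u(t,y)‖ ≤ C₀/(‖y‖ + √(−t))` at a time `t ≤ −s₀² < 0` lies in the decay
class with constant `C₀ (1 + s₀)/min(s₀, 1)` (`decay_of_profile`). [folklore] -/
theorem rss_decay_of_typeI (hI : ∀ t ∈ Iio (0 : ℝ), ∀ x, ‖u t x‖ ≤ C₀ / (‖x‖ + Real.sqrt (-t)))
    {s₀ t : ℝ} (hs₀ : 0 < s₀) (ht : t ≤ -s₀ ^ 2) (y : EuclideanSpace ℝ (Fin 3)) :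
    ‖u t y‖ ≤ C₀ * (1 + s₀) / min s₀ 1 / (1 + ‖y‖) := by
  have ht0 : t < 0 := by nlinarith
  have hC : 0 ≤ C₀ := by
    have h := (norm_nonneg _).trans (hI t ht0 0)
    rw [norm_zero, zero_add] at h
    exact (div_nonneg_iff.1 h).elim (fun h => h.1) fun h =>
      absurd h.2 (not_le.2 (Real.sqrt_pos.2 (neg_pos.2 ht0)))
  have hsq : s₀ ≤ Real.sqrt (-t) := by
    rw [show s₀ = Real.sqrt (s₀ ^ 2) by rw [Real.sqrt_sq hs₀.le]]
    exact Real.sqrt_le_sqrt (by linarith)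
  have hprof : ∀ y, ‖u t y‖ ≤ C₀ / (‖y - 0‖ + s₀) := fun y => by
    rw [sub_zero]
    exact (hI t ht0 y).trans (div_le_div_of_nonneg_left hC (by positivity) (by linarith))
  have h := decay_of_profile hs₀ hprof y
  rwa [norm_zero, add_zero] at h

/-- **The pressure of a Type I classical solution on `(−∞, 0)` is the potential up to the time
gauge `c(t) = p(t, 0) − Q[u(t)](0)`**: `p(t, x) − c(t) = Q[u(t)](x)` for `t < 0`
(`gradient_pressure_eq_of_typeI_vertex`: equal gradients, hence a constant difference).
[cite: PineauVicol2026, Lemma 7.1 (proof, p. 24), footnote 21] -/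
theorem rss_pressure_sub_gauge_eq (hsol : IsClassicalNSSolutionOn (Iio (0 : ℝ)) 1 0 u p)
    (hI : ∀ t ∈ Iio (0 : ℝ), ∀ x, ‖u t x‖ ≤ C₀ / (‖x‖ + Real.sqrt (-t))) {t : ℝ} (ht : t < 0)
    (x : EuclideanSpace ℝ (Fin 3)) :
    p t x - (p t 0 - pressurePotential (u t) 0) = pressurePotential (u t) x := by
  have hs : 0 < Real.sqrt (-t) := Real.sqrt_pos.2 (neg_pos.2 ht)
  have hdec := rss_decay_of_typeI hI hs (le_of_eq (by rw [Real.sq_sqrt (neg_pos.2 ht).le, neg_neg]))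
  have hI' : ∀ t ∈ Iio (0 : ℝ), ∀ x, ‖u t x‖ ≤ C₀ / (‖x - 0‖ + Real.sqrt (0 - t)) := fun t ht x => by
    rw [sub_zero, zero_sub]; exact hI t ht x
  have hq1 : ContDiff ℝ 1 (p t) := (hsol.contDiff_pressure (mem_Iio.2 ht)).of_le (by norm_cast)
  have hv4 : ContDiff ℝ 4 (u t) := (hsol.contDiff_velocity (mem_Iio.2 ht)).of_le (by norm_cast)
  have hQ2 : ContDiff ℝ 2 (pressurePotential (u t)) := contDiff_pressurePotential_decay hv4 hdec
  have hdp : Differentiable ℝ (p t) := hq1.differentiable one_ne_zero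
  have hdQ : Differentiable ℝ (pressurePotential (u t)) := hQ2.differentiable (by norm_num)
  have hzero : ∀ ξ, fderiv ℝ (fun ξ => p t ξ - pressurePotential (u t) ξ) ξ = 0 := by
    intro ξ
    have hg := gradient_pressure_eq_of_typeI_vertex hsol hI' ht ξ
    rw [gradient, gradient] at hg
    have hfd : fderiv ℝ (p t) ξ = fderiv ℝ (pressurePotential (u t)) ξ :=
      (InnerProductSpace.toDual ℝ (EuclideanSpace ℝ (Fin 3))).symm.injective hg
    have ef : (fun ξ => p t ξ - pressurePotential (u t) ξ) = p t - pressurePotential (u t) := rfl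
    rw [ef, fderiv_sub (hdp ξ) (hdQ ξ), hfd, sub_self]
  have hconst := is_const_of_fderiv_eq_zero (hdp.sub hdQ) hzero x 0
  simp only [Pi.sub_apply] at hconst
  linarith

/-- **A measurable bounded modification of the gauge on a compact time window.** For
`a ≤ b < 0` there is a measurable, bounded `g : ℝ → ℝ` with `g(t) = p(t,0) − Q[u(t)](0)` on
`[a, b]` (shift the window to `[0, T]`, clamp the time, and use
`measurable_pressurePotential_clamp`, `exists_bound_pressurePotential_decay`). [folklore] -/
theorem rss_exists_measurable_gauge (hsol : IsClassicalNSSolutionOn (Iio (0 : ℝ)) 1 0 u p)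
    (hI : ∀ t ∈ Iio (0 : ℝ), ∀ x, ‖u t x‖ ≤ C₀ / (‖x‖ + Real.sqrt (-t))) {a b : ℝ} (hab : a ≤ b)
    (hb : b < 0) :
    ∃ g : ℝ → ℝ, Measurable g ∧ (∃ M, ∀ t, |g t| ≤ M) ∧
      ∀ t ∈ Icc a b, g t = p t 0 - pressurePotential (u t) 0 := by
  set T : ℝ := b / 2 - a with hT
  have hT0 : 0 < T := by rw [hT]; linarith
  have hwin : ∀ s ∈ Icc (0 : ℝ) T, s + a ∈ Iio (0 : ℝ) := fun s hs => by
    simp only [mem_Iio]; linarith [hs.2]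
  have hsm : IsSmoothSpaceTimeOn (Icc 0 T) (fun s => u (s + a)) :=
    (hsol.smooth_velocity.comp_add_right a).mono hwin
  have hpm : IsSmoothSpaceTimeOn (Icc 0 T) (fun s => p (s + a)) :=
    (hsol.smooth_pressure.comp_add_right a).mono hwin
  -- the decay class on the window, scale `s₀ = √(−b/2)`
  have hs₀ : 0 < Real.sqrt (-(b / 2)) := Real.sqrt_pos.2 (by linarith)
  have hdec : ∀ s ∈ Icc (0 : ℝ) T, ∀ y, ‖u (s + a) y‖ ≤
      C₀ * (1 + Real.sqrt (-(b / 2))) / min (Real.sqrt (-(b / 2))) 1 / (1 + ‖y‖) :=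
    fun s hs y => rss_decay_of_typeI hI hs₀ (by rw [Real.sq_sqrt (by linarith)]; linarith [hs.2]) y
  set g : ℝ → ℝ := fun t => p (max 0 (min (t - a) T) + a) 0 -
    pressurePotential (u (max 0 (min (t - a) T) + a)) 0 with hg
  refine ⟨g, ?_, ?_, fun t ht => ?_⟩
  · have h1 := measurable_pressurePotential_clamp hT0 hsm
    have h2 : Continuous fun r : ℝ => p (max 0 (min r T) + a) 0 := by
      have h := continuous_clamp_comp hT0.le (F := uncurry fun s y => p (s + a) y)
        hpm.continuousOn continuous_const (g := fun _ : ℝ => (0 : EuclideanSpace ℝ (Fin 3)))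
      exact h.comp (continuous_id.prodMk continuous_id)
    exact (h2.measurable.sub h1).comp (measurable_id.sub_const a)
  · obtain ⟨MQ, hMQ⟩ := exists_bound_pressurePotential_decay hT0 hsm hdec
    obtain ⟨Mq, hMq⟩ : ∃ Mq, ∀ s ∈ Icc (0 : ℝ) T, |p (s + a) 0| ≤ Mq := by
      have hc' : ContinuousOn (fun s : ℝ => p (s + a) 0) (Icc 0 T) :=
        hpm.continuousOn.comp (continuous_id.prodMk continuous_const).continuousOn
          fun s hs => mk_mem_prod hs (mem_univ _)
      obtain ⟨M, hM⟩ := isCompact_Icc.exists_bound_of_continuousOn hc'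
      exact ⟨M, fun s hs => by have := hM s hs; rwa [Real.norm_eq_abs] at this⟩
    refine ⟨Mq + MQ, fun t => ?_⟩
    have hπ : max 0 (min (t - a) T) ∈ Icc (0 : ℝ) T := clamp_mem hT0.le (t - a)
    calc |g t| ≤ |p (max 0 (min (t - a) T) + a) 0| +
          |pressurePotential (u (max 0 (min (t - a) T) + a)) 0| := abs_sub _ _
      _ ≤ Mq + MQ := add_le_add (hMq _ hπ) (hMQ _ hπ)
  · have hta : t - a ∈ Icc (0 : ℝ) T := ⟨by linarith [ht.1], by rw [hT]; linarith [ht.2]⟩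
    rw [hg]; dsimp only
    rw [clamp_eq hta, sub_add_cancel]

/-- **The gauge is integrable and in `L^{3/2}` on compact subsets of the unit parabolic ball**
(it is bounded and agrees with a measurable function on the compact time projection, which
stays at times `≤ b < 0`). [folklore] -/
theorem rss_gauge_integrableOn_compact (hsol : IsClassicalNSSolutionOn (Iio (0 : ℝ)) 1 0 u p)
    (hI : ∀ t ∈ Iio (0 : ℝ), ∀ x, ‖u t x‖ ≤ C₀ / (‖x‖ + Real.sqrt (-t)))
    {K : Set (ℝ × EuclideanSpace ℝ (Fin 3))}
    (hK : K ⊆ parabolicCylinder 1 (0 : ℝ × EuclideanSpace ℝ (Fin 3))) (hKc : IsCompact K) :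
    IntegrableOn (fun z : ℝ × EuclideanSpace ℝ (Fin 3) => p z.1 0 - pressurePotential (u z.1) 0)
        K volume ∧
      ∫⁻ z in K, ‖p z.1 0 - pressurePotential (u z.1) 0‖ₑ ^ (3 / 2 : ℝ) < ⊤ := by
  rcases K.eq_empty_or_nonempty with rfl | hne
  · simp
  -- the time projection of `K` lies in some `[a, b]`, `b < 0`
  obtain ⟨z₁, hz₁, h₁⟩ := hKc.exists_isMinOn hne continuous_fst.continuousOn
  obtain ⟨z₂, hz₂, h₂⟩ := hKc.exists_isMaxOn hne continuous_fst.continuousOn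
  have hb : z₂.1 < 0 := by
    have := (mem_parabolicCylinder.1 (hK hz₂)).1.2
    simpa using this
  have hab : z₁.1 ≤ z₂.1 := h₁ hz₂
  have hwin : ∀ z ∈ K, z.1 ∈ Icc z₁.1 z₂.1 := fun z hz => ⟨h₁ hz, h₂ hz⟩
  obtain ⟨g, hgm, ⟨M, hM⟩, hg⟩ := rss_exists_measurable_gauge hsol hI hab hb
  have hKm : MeasurableSet K := hKc.isClosed.measurableSet
  have heq : EqOn (fun z : ℝ × EuclideanSpace ℝ (Fin 3) => g z.1)
      (fun z => p z.1 0 - pressurePotential (u z.1) 0) K := fun z hz => hg z.1 (hwin z hz)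
  have hfin : volume K < ⊤ := hKc.measure_lt_top
  refine ⟨?_, ?_⟩
  · refine IntegrableOn.congr_fun ?_ heq hKm
    exact Measure.integrableOn_of_bounded hfin.ne
      (hgm.comp measurable_fst).aestronglyMeasurable (M := M)
      (Eventually.of_forall fun z => by rw [Real.norm_eq_abs]; exact hM z.1)
  · calc ∫⁻ z in K, ‖p z.1 0 - pressurePotential (u z.1) 0‖ₑ ^ (3 / 2 : ℝ)
        ≤ ∫⁻ z in K, ENNReal.ofReal M ^ (3 / 2 : ℝ) := by
          refine setLIntegral_mono' hKm fun z hz => ?_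
          have e := heq hz
          dsimp only at e
          rw [← e]
          refine ENNReal.rpow_le_rpow ?_ (by norm_num)
          rw [Real.enorm_eq_ofReal_abs]
          exact ENNReal.ofReal_le_ofReal (hM z.1)
      _ < ⊤ := by
          rw [setLIntegral_const]
          exact ENNReal.mul_lt_top (ENNReal.rpow_lt_top_of_nonneg (by norm_num) ENNReal.ofReal_ne_top) hfin

/-! ## The registered tools stub -/

/-- **Tools stub `stub_rssPressureMassTools`** (helper tools for `stub_rssDecaySuitableInBall`):
the conjunction of the lemmas of this file — the global `L²` bound of the pressure potential on
the decay class, the slice bound for dilated profiles, the time-singular integrals, the decay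
class of Type I slices, the pressure identification `p − c = Q[u(t)]`, and the integrability of
the gauge on compact subsets of the unit parabolic ball. [folklore] -/
theorem stub_rssPressureMassTools : (∃ K : ℝ, 0 ≤ K ∧ ∀ (V : EuclideanSpace ℝ (Fin 3) → EuclideanSpace ℝ (Fin 3)) (C₀ : ℝ), ContDiff ℝ (⊤ : ℕ∞) V → (∀ y, ‖V y‖ ≤ C₀ / (1 + ‖y‖)) → ∫⁻ x, ‖Literature.Analysis.FluidPDE.pressurePotential V x‖ₑ ^ 2 ≤ ENNReal.ofReal (K * C₀ ^ 4)) ∧ (∀ (K : ℝ), (∀ (V : EuclideanSpace ℝ (Fin 3) → EuclideanSpace ℝ (Fin 3)) (C₀ : ℝ), ContDiff ℝ (⊤ : ℕ∞) V → (∀ y, ‖V y‖ ≤ C₀ / (1 + ‖y‖)) → ∫⁻ x, ‖Literature.Analysis.FluidPDE.pressurePotential V x‖ₑ ^ 2 ≤ ENNReal.ofReal (K * C₀ ^ 4)) → ∀ (v : EuclideanSpace ℝ (Fin 3) → EuclideanSpace ℝ (Fin 3)), ContDiff ℝ (⊤ : ℕ∞) v → ∀ (C₀ C₁ lam : ℝ),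 0 < lam → (∀ x, ‖v x‖ ≤ C₁ / (1 + ‖x‖)) → (∀ y, ‖lam⁻¹ • v (lam⁻¹ • y)‖ ≤ C₀ / (1 + ‖y‖)) → ∫⁻ x in Metric.ball (0 : EuclideanSpace ℝ (Fin 3)) 1, ‖Literature.Analysis.FluidPDE.pressurePotential v x‖ₑ ^ (3 / 2 : ℝ) ≤ ENNReal.ofReal (lam * (K * C₀ ^ 4)) ^ (3 / 4 : ℝ) * MeasureTheory.volume (Metric.ball (0 : EuclideanSpace ℝ (Fin 3)) 1) ^ (1 / 4 : ℝ)) ∧ (∀ r : ℝ, -1 < r → ∫⁻ t in Set.Ioo (-1 : ℝ) 0, ENNReal.ofReal ((-t) ^ r) < ⊤) ∧ (∀ (u : ℝ → EuclideanSpace ℝ (Fin 3) → EuclideanSpace ℝ (Fin 3)) (C₀ : ℝ), (∀ t ∈ Set.Iio (0:ℝ), ∀ x, ‖u t x‖ ≤ C₀ / (‖x‖ + Real.sqrt (-t))) → ∀ (s₀ t : ℝ), 0 < s₀ → t ≤ -s₀ ^ 2 → ∀ y, ‖u t y‖ ≤ C₀ * (1 + s₀) / min s₀ 1 / (1 + ‖y‖))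 ∧ (∀ (u : ℝ → EuclideanSpace ℝ (Fin 3) → EuclideanSpace ℝ (Fin 3)) (p : ℝ → EuclideanSpace ℝ (Fin 3) → ℝ) (C₀ : ℝ), Literature.Analysis.FluidPDE.IsClassicalNSSolutionOn (Set.Iio 0) 1 0 u p → (∀ t ∈ Set.Iio (0:ℝ), ∀ x, ‖u t x‖ ≤ C₀ / (‖x‖ + Real.sqrt (-t))) → ∀ t : ℝ, t < 0 → ∀ x, p t x - (p t 0 - Literature.Analysis.FluidPDE.pressurePotential (u t) 0) = Literature.Analysis.FluidPDE.pressurePotential (u t) x) ∧ (∀ (u : ℝ → EuclideanSpace ℝ (Fin 3) → EuclideanSpace ℝ (Fin 3)) (p : ℝ → EuclideanSpace ℝ (Fin 3) → ℝ) (C₀ : ℝ), Literature.Analysis.FluidPDE.IsClassicalNSSolutionOn (Set.Iio 0) 1 0 u p → (∀ t ∈ Set.Iio (0:ℝ), ∀ x, ‖u t x‖ ≤ C₀ / (‖x‖ + Real.sqrt (-t))) → ∀ K : Set (ℝ × EuclideanSpace ℝ (Fin 3)), K ⊆ Literature.Analysis.FluidPDE.parabolicCylinder 1 (0 : ℝ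 × EuclideanSpace ℝ (Fin 3)) → IsCompact K → MeasureTheory.IntegrableOn (fun z : ℝ × EuclideanSpace ℝ (Fin 3) => p z.1 0 - Literature.Analysis.FluidPDE.pressurePotential (u z.1) 0) K MeasureTheory.volume ∧ ∫⁻ z in K, ‖p z.1 0 - Literature.Analysis.FluidPDE.pressurePotential (u z.1) 0‖ₑ ^ (3 / 2 : ℝ) < ⊤) :=
  ⟨rss_lintegral_enorm_sq_pressurePotential_le,
    fun _ hK _ hv _ _ _ hlam hv₁ hV => rss_lintegral_ball_rpow_pressurePotential_le hK hv hlam hv₁ hV,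
    fun _ hr => rss_lintegral_Ioo_neg_rpow_lt_top hr,
    fun _ _ hI _ _ hs₀ ht y => rss_decay_of_typeI hI hs₀ ht y,
    fun _ _ _ hsol hI _ ht x => rss_pressure_sub_gauge_eq hsol hI ht x,
    fun _ _ _ hsol hI _ hK hKc => rss_gauge_integrableOn_compact hsol hI hK hKc⟩

end Summit.NavierStokesRegularity.NavierStokesRegularity.Theorems.FrequencyRigidity.ScaledEnergySplit
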